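import Summits.CriticalPhenomena.PercolationContinuityZ3.Theorems.PercNearOneGluingNoHeavyLowerTailSahiGridPatternRoundingSwap
import Summits.CriticalPhenomena.PercolationContinuityZ3.Theorems.PercNearOneGluingNoHeavyLowerTailSahiGridPatternRoundingNeg
import Summits.CriticalPhenomena.PercolationContinuityZ3.Theorems.PercNearOneGluingNoHeavyLowerTailSahiGridPatternReduce

/-!
# `NoHeavyLowerTail` (crux stmt-CriticalPhenomena-4575), Sahi programme P1: the rounding calculus, part 7 —
# **LEXICOGRAPHIC MINIMISERS**: the rounding alternative need only be proved for extremal negative triples, and what extremality buys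

Support file (seat `prim-sahi-p1`, generation 13; `--supports stmt-CriticalPhenomena-4575`).  Pure proofs; definitions: `unresCount` (number of
unresolved axes), `upTriples d` (the finite set of up-set triples), `IsLexMin` (lexicographic extremality) and the `Prop` `RoundingAlternativeMin d`
(an obligation / hypothesis, never a fact); no `sorry`, standard axioms.

THE MATHEMATICS (Lieb–Sahi's extremal argument [Lieb–Sahi 2022, proof of Thm 2.9] organised for `[3]^d`).  Order the up-set triples of `[3]^d`
lexicographically by (1) the value of `sStarD` (smallest first), (2) the number of UNRESOLVED axes (fewest first), (3) the total size
`#A + #B + #C` (largest first); a triple extremal for this order is a LEX-MINIMISER (`IsLexMin`; one exists, `exists_isLexMin`).  Then: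
* (`IsLexMin.lt_rnd`) at a lex-minimiser EVERY simultaneous rounding on an unresolved axis STRICTLY increases `sStarD` (it resolves the axis,
  `unresCount_rnd_lt`); so the rounding alternative at a lex-minimiser is the statement that a NEGATIVE lex-minimiser has no unresolved axis:
  **`RoundingAlternativeMin d`**, and **`patternPos_of_roundingAlternativeMin : RoundingAlternativeMin d → ResolvedPos d → PatternPos d`**,
  **`patternPos_iff_resolvedPos_and_roundingAlternativeMin`** (lossless), `roundingAlternativeMin_of_neg` (it is the weakest of the chain
  `RoundingAlternative → RoundingAlternativeNeg → RoundingAlternativeMin`).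
* What extremality buys (usable hypotheses for whoever proves the alternative): `IsLexMin.sStarD_le` (global minimality: no up-set triple is
  lower — in particular no partial rounding, no single-cell move decreases the functional); `IsLexMin.axInv_of_axInv₂₃` (&c.: on an unresolved axis
  NO level pair is owned by a single set — Lieb–Sahi linearity would resolve it for free); `IsLexMin.yProfile_nonneg_of_insert` / `…_eq_zero_of_insert`
  (adding an addable cell never lowers the functional, so an addable cell outside `B ∩ C` has marginal value exactly `0`) and
  `IsLexMin.yProfile_eq_zero_of_erase` (a removable cell inside `B ∩ C` has marginal value exactly `0`) — the first-order (F1/F2) conditions.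
  (The orbit version of F1, `max(Aᶜ) ⊆ B ∩ C` outright via symmetric additions on resolved axes, is not formalised here.)
HONEST LABEL (seat census, generation 13): F1-extremality does NOT by itself force a good rounding at every shared level pair for `d ≥ 4` (it does,
exhaustively, at `d = 3`), so a proof of `RoundingAlternativeMin d` must still couple the two level pairs of an axis; `RoundingAlternativeMin d`,
`PatternPos d` (`d ≥ 4`), Kahn's Conjecture 5 and Sahi's `C₃` remain OPEN and nothing here asserts them. [this work]
-/

namespace Summit.CriticalPhenomena.PercolationContinuityZ3.Theorems.SahiGridPattern

open Finset
open scoped Classical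

variable {d : ℕ}

/-! ### Unresolved axes -/

/-- The number of unresolved axes of a triple. [this work] -/
noncomputable def unresCount (A B C : Finset (Pd d)) : ℕ := (univ.filter fun a => ¬ Resolved a A B C).card

/-- A triple with no unresolved axis is resolved everywhere. [this work] -/
theorem resolved_of_unresCount_eq_zero {A B C : Finset (Pd d)} (h : unresCount A B C = 0) (a : Fin d) : Resolved a A B C := by
  by_contra hna
  have hmem : a ∈ univ.filter fun a => ¬ Resolved a A B C := by simp [hna]
  unfold unresCount at h
  rw [card_eq_zero] at h
  rw [h] at hmem
  exact absurd hmem (Finset.notMem_empty a)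

/-- **Rounding all three sets on an unresolved axis strictly lowers the number of unresolved axes.** [this work] -/
theorem unresCount_rnd_lt (a : Fin d) (j : Fin 2) (sA sB sC : Bool) {A B C : Finset (Pd d)} (hA : IsUpperSet (A : Set (Pd d)))
    (hB : IsUpperSet (B : Set (Pd d))) (hC : IsUpperSet (C : Set (Pd d))) (ha : ¬ Resolved a A B C) :
    unresCount (rnd sA a j A) (rnd sB a j B) (rnd sC a j C) < unresCount A B C := by
  unfold unresCount
  have hsub : (univ.filter fun b => ¬ Resolved b (rnd sA a j A) (rnd sB a j B) (rnd sC a j C)) ⊆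
      (univ.filter fun b => ¬ Resolved b A B C).erase a := by
    intro b hb
    simp only [mem_filter, mem_univ, true_and, mem_erase] at hb ⊢
    refine ⟨?_, ?_⟩
    · rintro rfl; exact hb (resolved_rnd b j sA sB sC hA hB hC)
    · intro hres
      by_cases hba : b = a
      · subst hba; exact hb (resolved_rnd b j sA sB sC hA hB hC)
      · exact hb (resolved_rnd_of_ne hba j sA sB sC hres)
  have hmem : a ∈ univ.filter fun b => ¬ Resolved b A B C := by simp [ha]
  calc (univ.filter fun b => ¬ Resolved b (rnd sA a j A) (rnd sB a j B) (rnd sC a j C)).card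
      ≤ ((univ.filter fun b => ¬ Resolved b A B C).erase a).card := card_le_card hsub
    _ < (univ.filter fun b => ¬ Resolved b A B C).card := card_erase_lt_of_mem hmem

/-! ### Lexicographic minimisers -/

/-- The finite set of up-set triples of `[3]^d`. [this work] -/
noncomputable def upTriples (d : ℕ) : Finset (Finset (Pd d) × Finset (Pd d) × Finset (Pd d)) :=
  univ.filter fun t => IsUpperSet (t.1 : Set (Pd d)) ∧ IsUpperSet (t.2.1 : Set (Pd d)) ∧ IsUpperSet (t.2.2 : Set (Pd d))

/-- Membership in `upTriples`. [this work] -/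
theorem mem_upTriples {t : Finset (Pd d) × Finset (Pd d) × Finset (Pd d)} :
    t ∈ upTriples d ↔ IsUpperSet (t.1 : Set (Pd d)) ∧ IsUpperSet (t.2.1 : Set (Pd d)) ∧ IsUpperSet (t.2.2 : Set (Pd d)) := by
  unfold upTriples; simp only [mem_filter, mem_univ, true_and]

/-- **Lexicographic extremality**: an up-set triple minimising `sStarD`, then the number of unresolved axes, then maximising the total size.
[this work] -/
def IsLexMin (A B C : Finset (Pd d)) : Prop :=
  IsUpperSet (A : Set (Pd d)) ∧ IsUpperSet (B : Set (Pd d)) ∧ IsUpperSet (C : Set (Pd d)) ∧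
    (∀ A' B' C' : Finset (Pd d), IsUpperSet (A' : Set (Pd d)) → IsUpperSet (B' : Set (Pd d)) → IsUpperSet (C' : Set (Pd d)) →
      sStarD A B C ≤ sStarD A' B' C') ∧
    (∀ A' B' C' : Finset (Pd d), IsUpperSet (A' : Set (Pd d)) → IsUpperSet (B' : Set (Pd d)) → IsUpperSet (C' : Set (Pd d)) →
      sStarD A' B' C' = sStarD A B C → unresCount A B C ≤ unresCount A' B' C') ∧
    (∀ A' B' C' : Finset (Pd d), IsUpperSet (A' : Set (Pd d)) → IsUpperSet (B' : Set (Pd d)) → IsUpperSet (C' : Set (Pd d)) →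
      sStarD A' B' C' = sStarD A B C → unresCount A' B' C' = unresCount A B C → A'.card + B'.card + C'.card ≤ A.card + B.card + C.card)

/-- **A lexicographic minimiser exists** (the set of up-set triples is finite and nonempty). [this work] -/
theorem exists_isLexMin (d : ℕ) : ∃ A B C : Finset (Pd d), IsLexMin A B C := by
  have h0 : ((∅ : Finset (Pd d)), (∅ : Finset (Pd d)), (∅ : Finset (Pd d))) ∈ upTriples d :=
    mem_upTriples.2 ⟨by simp [isUpperSet_empty], by simp [isUpperSet_empty], by simp [isUpperSet_empty]⟩
  obtain ⟨t₁, ht₁, hmin₁⟩ := exists_min_image (upTriples d) (fun t => sStarD t.1 t.2.1 t.2.2) ⟨_, h0⟩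
  have ht₁2 : t₁ ∈ (upTriples d).filter fun t => sStarD t.1 t.2.1 t.2.2 = sStarD t₁.1 t₁.2.1 t₁.2.2 :=
    mem_filter.2 ⟨ht₁, rfl⟩
  obtain ⟨t₂, ht₂, hmin₂⟩ := exists_min_image _
    (fun t : Finset (Pd d) × Finset (Pd d) × Finset (Pd d) => unresCount t.1 t.2.1 t.2.2) ⟨_, ht₁2⟩
  have ht₂3 : t₂ ∈ ((upTriples d).filter fun t => sStarD t.1 t.2.1 t.2.2 = sStarD t₁.1 t₁.2.1 t₁.2.2).filter
      fun t => unresCount t.1 t.2.1 t.2.2 = unresCount t₂.1 t₂.2.1 t₂.2.2 :=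
    mem_filter.2 ⟨ht₂, rfl⟩
  obtain ⟨t₃, ht₃, hmax₃⟩ := exists_max_image _
    (fun t : Finset (Pd d) × Finset (Pd d) × Finset (Pd d) => t.1.card + t.2.1.card + t.2.2.card) ⟨_, ht₂3⟩
  have ht₃2 := (mem_filter.1 ht₃).1
  have ht₃u : unresCount t₃.1 t₃.2.1 t₃.2.2 = unresCount t₂.1 t₂.2.1 t₂.2.2 := (mem_filter.1 ht₃).2
  have ht₃1 : t₃ ∈ upTriples d := (mem_filter.1 ht₃2).1
  have ht₃m : sStarD t₃.1 t₃.2.1 t₃.2.2 = sStarD t₁.1 t₁.2.1 t₁.2.2 := (mem_filter.1 ht₃2).2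
  have hA : IsUpperSet (t₃.1 : Set (Pd d)) := (mem_upTriples.1 ht₃1).1
  have hB : IsUpperSet (t₃.2.1 : Set (Pd d)) := (mem_upTriples.1 ht₃1).2.1
  have hC : IsUpperSet (t₃.2.2 : Set (Pd d)) := (mem_upTriples.1 ht₃1).2.2
  have k1 : ∀ A' B' C' : Finset (Pd d), IsUpperSet (A' : Set (Pd d)) → IsUpperSet (B' : Set (Pd d)) →
      IsUpperSet (C' : Set (Pd d)) → sStarD t₃.1 t₃.2.1 t₃.2.2 ≤ sStarD A' B' C' := by
    intro A' B' C' hA' hB' hC'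
    have hmem : (A', B', C') ∈ upTriples d := mem_upTriples.2 ⟨hA', hB', hC'⟩
    have h1 : sStarD t₁.1 t₁.2.1 t₁.2.2 ≤ sStarD A' B' C' := hmin₁ (A', B', C') hmem
    omega
  have k2 : ∀ A' B' C' : Finset (Pd d), IsUpperSet (A' : Set (Pd d)) → IsUpperSet (B' : Set (Pd d)) →
      IsUpperSet (C' : Set (Pd d)) → sStarD A' B' C' = sStarD t₃.1 t₃.2.1 t₃.2.2 →
        unresCount t₃.1 t₃.2.1 t₃.2.2 ≤ unresCount A' B' C' := by
    intro A' B' C' hA' hB' hC' hS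
    have hmem : (A', B', C') ∈ (upTriples d).filter fun t => sStarD t.1 t.2.1 t.2.2 = sStarD t₁.1 t₁.2.1 t₁.2.2 :=
      mem_filter.2 ⟨mem_upTriples.2 ⟨hA', hB', hC'⟩, hS.trans ht₃m⟩
    have h2 : unresCount t₂.1 t₂.2.1 t₂.2.2 ≤ unresCount A' B' C' := hmin₂ (A', B', C') hmem
    omega
  have k3 : ∀ A' B' C' : Finset (Pd d), IsUpperSet (A' : Set (Pd d)) → IsUpperSet (B' : Set (Pd d)) →
      IsUpperSet (C' : Set (Pd d)) → sStarD A' B' C' = sStarD t₃.1 t₃.2.1 t₃.2.2 →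
        unresCount A' B' C' = unresCount t₃.1 t₃.2.1 t₃.2.2 → A'.card + B'.card + C'.card ≤ t₃.1.card + t₃.2.1.card + t₃.2.2.card := by
    intro A' B' C' hA' hB' hC' hS hU
    have hmem : (A', B', C') ∈ ((upTriples d).filter fun t => sStarD t.1 t.2.1 t.2.2 = sStarD t₁.1 t₁.2.1 t₁.2.2).filter
        fun t => unresCount t.1 t.2.1 t.2.2 = unresCount t₂.1 t₂.2.1 t₂.2.2 :=
      mem_filter.2 ⟨mem_filter.2 ⟨mem_upTriples.2 ⟨hA', hB', hC'⟩, hS.trans ht₃m⟩, hU.trans ht₃u⟩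
    exact hmax₃ (A', B', C') hmem
  exact ⟨t₃.1, t₃.2.1, t₃.2.2, hA, hB, hC, k1, k2, k3⟩

namespace IsLexMin

variable {A B C : Finset (Pd d)}

/-- The components are up-sets. [this work] -/
theorem isUpperSet₁ (h : IsLexMin A B C) : IsUpperSet (A : Set (Pd d)) := h.1

/-- The components are up-sets. [this work] -/
theorem isUpperSet₂ (h : IsLexMin A B C) : IsUpperSet (B : Set (Pd d)) := h.2.1

/-- The components are up-sets. [this work] -/
theorem isUpperSet₃ (h : IsLexMin A B C) : IsUpperSet (C : Set (Pd d)) := h.2.2.1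

/-- **Global minimality**: no up-set triple has a smaller functional (in particular no partial rounding and no single-cell move lowers it).
[this work] -/
theorem sStarD_le (h : IsLexMin A B C) {A' B' C' : Finset (Pd d)} (hA' : IsUpperSet (A' : Set (Pd d)))
    (hB' : IsUpperSet (B' : Set (Pd d))) (hC' : IsUpperSet (C' : Set (Pd d))) : sStarD A B C ≤ sStarD A' B' C' :=
  h.2.2.2.1 A' B' C' hA' hB' hC'

/-- **At a lex-minimiser every simultaneous rounding on an unresolved axis STRICTLY increases the functional.** [this work] -/
theorem lt_rnd (h : IsLexMin A B C) {a : Fin d} (ha : ¬ Resolved a A B C) (j : Fin 2) (sA sB sC : Bool) :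
    sStarD A B C < sStarD (rnd sA a j A) (rnd sB a j B) (rnd sC a j C) := by
  have hA := h.isUpperSet₁; have hB := h.isUpperSet₂; have hC := h.isUpperSet₃
  have hle := h.sStarD_le (isUpperSet_rnd sA a j hA) (isUpperSet_rnd sB a j hB) (isUpperSet_rnd sC a j hC)
  rcases lt_or_eq_of_le hle with hlt | heq
  · exact hlt
  · exfalso
    have hu := h.2.2.2.2.1 _ _ _ (isUpperSet_rnd sA a j hA) (isUpperSet_rnd sB a j hB) (isUpperSet_rnd sC a j hC) heq.symm
    exact absurd (unresCount_rnd_lt a j sA sB sC hA hB hC ha) (not_lt.2 hu)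

/-- **No single-owner level pair on an unresolved axis** (first slot): if `B` and `C` are `(lo hi)`-invariant at `(a, j)` then so is `A` —
otherwise Lieb–Sahi linearity would give a free resolving rounding. [this work] -/
theorem axInv_of_axInv₂₃ (h : IsLexMin A B C) {a : Fin d} (ha : ¬ Resolved a A B C) (j : Fin 2)
    (hB : AxInv a (lo j) (hi j) B) (hC : AxInv a (lo j) (hi j) C) : AxInv a (lo j) (hi j) A := by
  by_contra hAinv
  have hA := h.isUpperSet₁
  have hmin := min_sStarD_round_le a j hA hB hC
  rcases le_total (sStarD (roundUp a j A) B C) (sStarD (roundDown a j A) B C) with hle | hle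
  · rw [min_eq_left hle] at hmin
    have hlt := h.lt_rnd ha j true true true
    rw [rnd_true, rnd_eq_self_of_axInv true hB, rnd_eq_self_of_axInv true hC] at hlt
    exact absurd hmin (not_le.2 hlt)
  · rw [min_eq_right hle] at hmin
    have hlt := h.lt_rnd ha j false true true
    rw [rnd_false, rnd_eq_self_of_axInv true hB, rnd_eq_self_of_axInv true hC] at hlt
    exact absurd hmin (not_le.2 hlt)

/-- The marginal value of a cell `x` for the first slot is the `yProfile` of the other two sets. [this work] -/
theorem sStarD_singleton_eq_yProfile (x : Pd d) (B C : Finset (Pd d)) : sStarD ({x} : Finset (Pd d)) B C = yProfile B C x := by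
  rw [sStarD_swap12, sStarD_swap23, sStarD_eq_sum_yProfile, Finset.sum_singleton]

/-- **F1, first-order form**: adding an addable cell (one whose addition keeps `A` an up-set) never lowers the functional at a lex-minimiser,
so its marginal value is `≥ 0`. [this work] -/
theorem yProfile_nonneg_of_insert (h : IsLexMin A B C) {x : Pd d} (hx : x ∉ A) (hup : IsUpperSet ((insert x A : Finset (Pd d)) : Set (Pd d))) :
    0 ≤ yProfile B C x := by
  have hle := h.sStarD_le hup h.isUpperSet₂ h.isUpperSet₃
  rw [sStarD_insert_first hx, sStarD_singleton_eq_yProfile] at hle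
  linarith

/-- **F1, equality form**: an addable cell OUTSIDE `B ∩ C` has marginal value exactly `0` at a lex-minimiser (its value is `≤ 0` off `B ∩ C` for
all up-set triples, `yProfile_nonpos_of_not_mem`). [this work] -/
theorem yProfile_eq_zero_of_insert (h : IsLexMin A B C) {x : Pd d} (hx : x ∉ A)
    (hup : IsUpperSet ((insert x A : Finset (Pd d)) : Set (Pd d))) (hxBC : x ∉ B ∩ C) : yProfile B C x = 0 :=
  le_antisymm (yProfile_nonpos_of_not_mem h.isUpperSet₂ h.isUpperSet₃ hxBC) (h.yProfile_nonneg_of_insert hx hup)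

/-- **F2, equality form**: a removable cell (one whose removal keeps `A` an up-set) INSIDE `B ∩ C` has marginal value exactly `0` at a
lex-minimiser (its value is `≥ 0` on `B ∩ C`, `yProfile_nonneg_of_mem`, and removing it cannot lower the functional). [this work] -/
theorem yProfile_eq_zero_of_erase (h : IsLexMin A B C) {x : Pd d} (hx : x ∈ A)
    (hup : IsUpperSet ((A.erase x : Finset (Pd d)) : Set (Pd d))) (hxBC : x ∈ B ∩ C) : yProfile B C x = 0 := by
  have hle := h.sStarD_le hup h.isUpperSet₂ h.isUpperSet₃
  have hx' : x ∉ A.erase x := fun hmem => (mem_erase.1 hmem).1 rfl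
  have hsplit : sStarD A B C = sStarD ({x} : Finset (Pd d)) B C + sStarD (A.erase x) B C := by
    conv_lhs => rw [← insert_erase hx]
    exact sStarD_insert_first hx' B C
  rw [sStarD_singleton_eq_yProfile] at hsplit
  have hnn := yProfile_nonneg_of_mem hxBC
  linarith

end IsLexMin

/-! ### The obligation at lex-minimisers and the lossless reduction -/

/-- **`RoundingAlternativeMin d`**: a NEGATIVE lexicographic minimiser has no unresolved axis (equivalently, by `IsLexMin.lt_rnd`: the rounding
alternative holds at negative lex-minimisers).  The weakest obligation of the chain `RoundingAlternative → RoundingAlternativeNeg →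
RoundingAlternativeMin`; an obligation / hypothesis, never a fact. [this work] [status: open for d ≥ 4] -/
@[conjecture] def RoundingAlternativeMin (d : ℕ) : Prop :=
  ∀ A B C : Finset (Pd d), IsLexMin A B C → sStarD A B C < 0 → ∀ a, Resolved a A B C

/-- The negative-triple alternative implies the lex-minimiser one. [this work] -/
theorem roundingAlternativeMin_of_neg (h : RoundingAlternativeNeg d) : RoundingAlternativeMin d := by
  intro A B C hmin hneg a
  by_contra ha
  obtain ⟨a', j, sA, sB, sC, ha', hle⟩ := h A B C hmin.isUpperSet₁ hmin.isUpperSet₂ hmin.isUpperSet₃ hneg ⟨a, ha⟩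
  exact absurd hle (not_le.2 (hmin.lt_rnd ha' j sA sB sC))

/-- The full alternative implies the lex-minimiser one. [this work] -/
theorem roundingAlternativeMin_of_roundingAlternative (h : RoundingAlternative d) : RoundingAlternativeMin d :=
  roundingAlternativeMin_of_neg (roundingAlternativeNeg_of_roundingAlternative h)

/-- `PatternPos d` implies the lex-minimiser alternative (there are no negative triples). [this work] -/
theorem roundingAlternativeMin_of_patternPos (h : PatternPos d) : RoundingAlternativeMin d :=
  fun A B C hmin hneg _ => absurd (h A B C hmin.isUpperSet₁ hmin.isUpperSet₂ hmin.isUpperSet₃) (not_le.2 hneg)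

/-- **THE REDUCTION AT LEX-MINIMISERS**: `RoundingAlternativeMin d → ResolvedPos d → PatternPos d`.  If some up-set triple were negative, a
lexicographic minimiser would be negative, hence (by the obligation) resolved on every axis, hence nonnegative by `ResolvedPos d`. [this work] -/
theorem patternPos_of_roundingAlternativeMin (hRA : RoundingAlternativeMin d) (hRP : ResolvedPos d) : PatternPos d := by
  intro A B C hA hB hC
  by_contra hneg
  push Not at hneg
  obtain ⟨A₀, B₀, C₀, hmin⟩ := exists_isLexMin d
  have hle : sStarD A₀ B₀ C₀ ≤ sStarD A B C := hmin.sStarD_le hA hB hC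
  have hneg₀ : sStarD A₀ B₀ C₀ < 0 := lt_of_le_of_lt hle hneg
  have hres := hRA A₀ B₀ C₀ hmin hneg₀
  have h0 := hRP A₀ B₀ C₀ hmin.isUpperSet₁ hmin.isUpperSet₂ hmin.isUpperSet₃ hres
  exact absurd hneg₀ (not_lt.2 h0)

/-- **Lossless form**: `PatternPos d ↔ ResolvedPos d ∧ RoundingAlternativeMin d`. [this work] -/
theorem patternPos_iff_resolvedPos_and_roundingAlternativeMin : PatternPos d ↔ ResolvedPos d ∧ RoundingAlternativeMin d :=
  ⟨fun h => ⟨resolvedPos_of_patternPos h, roundingAlternativeMin_of_patternPos h⟩,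
    fun h => patternPos_of_roundingAlternativeMin h.2 h.1⟩

end Summit.CriticalPhenomena.PercolationContinuityZ3.Theorems.SahiGridPattern
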